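import Summits.Ventures.PercRepro.LemmaBAbstract

/-!
# PercRepro — the antipodal kernel and the coordinate induction (seat p3, gen 3)

The engine behind `LemmaB3.lean` (Lemma B at `k = 3`). For a bounded order `L` and a family
`x : Fin r → L` of "crossing cells", the antipodal kernel is
`bKernel x a b = [a = ⊤ ∧ b = ⊥] + [a = ⊥ ∧ b = ⊤] − [a, b two distinct cells of x]`.

* `bKernel_local`: if the cells of `x` are atoms and coatoms of `L` (`IsAtomCoatomFamily`), then for
  `a₀ ≤ a₁`, `b₀ ≤ b₁` the kernel on the anti-diagonal dominates the kernel on the columns: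
  `f(a₀, b₁) + f(a₁, b₀) ≥ f(a₀, b₀) + f(a₁, b₁)`.
* `cubeAntipodalSum_nonneg`: **coordinate induction** — for every monotone `c : Finset S → L` and every
  `A : Finset S`, `Σ_{σ ⊆ A} f(c σ, c (A \ σ)) ≥ 0`. Splitting off a coordinate `r`, the antipodal
  pairs of the cube on `insert r A` are the anti-diagonals of the squares `σ ≤ σ ∪ r`,
  `A \ σ ≤ (A \ σ) ∪ r`, and the antipodal pairs of the two faces are their columns.
* `sum_bKernel_nonneg`: the same on the full cube `Config S`; `sum_bKernel_eq`: the antipodal sum is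
  `2·topBotCount − 2·crossCount` (typer-2's counts, `LemmaBAbstract.lean`).

This is exactly the structure of `M_n` (⊥, pairwise incomparable middle elements, ⊤) with any set of
middle elements as crossing cells. It does NOT apply verbatim to `Part(4)`: the `2+1+1` cells below a
crossing cell violate `IsAtomCoatomFamily.atom` (see `proofs/P3-lemmaB3.md` §4 for the exact
obstruction and the consequences).
-/

namespace PercRepro

open Finset

/-! ### The antipodal kernel and its local inequality -/

section Kernel

variable {L : Type*} [PartialOrder L] [BoundedOrder L] [Nontrivial L] {r : ℕ}

open Classical in
/-- The good part of the antipodal kernel: `1` on `(⊤, ⊥)` and on `(⊥, ⊤)`, `0` otherwise. -/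
noncomputable def goodKer (a b : L) : ℤ :=
  (if a = ⊤ ∧ b = ⊥ then 1 else 0) + (if a = ⊥ ∧ b = ⊤ then 1 else 0)

open Classical in
/-- The bad part of the antipodal kernel of a family `x`: `1` on two distinct cells of `x`. -/
noncomputable def badKer (x : Fin r → L) (a b : L) : ℤ :=
  if ∃ i j, i ≠ j ∧ a = x i ∧ b = x j then 1 else 0

/-- The antipodal kernel `good − bad`. -/
noncomputable def bKernel (x : Fin r → L) (a b : L) : ℤ := goodKer a b - badKer x a b

omit [Nontrivial L] in
/-- The good kernel is nonnegative. -/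
theorem goodKer_nonneg (a b : L) : 0 ≤ goodKer a b := by
  unfold goodKer; split_ifs <;> omega

omit [PartialOrder L] [BoundedOrder L] [Nontrivial L] in
/-- The bad kernel is nonnegative. -/
theorem badKer_nonneg (x : Fin r → L) (a b : L) : 0 ≤ badKer x a b := by
  unfold badKer; split_ifs <;> omega

/-- `goodKer ⊤ ⊥ = 1`. -/
theorem goodKer_top_bot : goodKer (⊤ : L) ⊥ = 1 := by
  unfold goodKer
  simp [top_ne_bot]

/-- `goodKer ⊥ ⊤ = 1`. -/
theorem goodKer_bot_top : goodKer (⊥ : L) ⊤ = 1 := by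
  unfold goodKer
  simp [bot_ne_top]

/-- `goodKer a a = 0`. -/
theorem goodKer_self (a : L) : goodKer a a = 0 := by
  unfold goodKer
  by_cases h : a = ⊤
  · subst h; simp [top_ne_bot]
  · simp [h]

/-- `goodKer` is submodular on the product order. -/
theorem goodKer_local {a₀ a₁ b₀ b₁ : L} (ha : a₀ ≤ a₁) (hb : b₀ ≤ b₁) :
    goodKer a₀ b₀ + goodKer a₁ b₁ ≤ goodKer a₀ b₁ + goodKer a₁ b₀ := by
  classical
  by_cases h1 : a₀ = ⊤
  · have ha1 : a₁ = ⊤ := top_le_iff.mp (h1 ▸ ha)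
    subst h1; subst ha1
    exact (add_comm _ _).le
  by_cases h2 : b₀ = ⊤
  · have hb1 : b₁ = ⊤ := top_le_iff.mp (h2 ▸ hb)
    subst h2; subst hb1
    exact le_rfl
  have h0 : goodKer a₀ b₀ = 0 := by unfold goodKer; simp [h1, h2]
  rw [h0, zero_add]
  by_cases h3 : a₁ = ⊤ ∧ b₁ = ⊥
  · obtain ⟨rfl, rfl⟩ := h3
    have hb0 : b₀ = ⊥ := le_bot_iff.mp hb
    subst hb0
    rw [goodKer_top_bot]
    have := goodKer_nonneg a₀ (⊥ : L)
    omega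
  by_cases h4 : a₁ = ⊥ ∧ b₁ = ⊤
  · obtain ⟨rfl, rfl⟩ := h4
    have ha0 : a₀ = ⊥ := le_bot_iff.mp ha
    subst ha0
    rw [goodKer_bot_top]
    have := goodKer_nonneg (⊥ : L) b₀
    omega
  have h5 : goodKer a₁ b₁ = 0 := by unfold goodKer; simp [h3, h4]
  rw [h5]
  have := goodKer_nonneg a₀ b₁
  have := goodKer_nonneg a₁ b₀
  omega

variable (x : Fin r → L)

/-- Hypotheses making the crossing cells atoms and coatoms of `L`. -/
structure IsAtomCoatomFamily : Prop where
  injective : Function.Injective x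
  ne_bot : ∀ i, x i ≠ ⊥
  ne_top : ∀ i, x i ≠ ⊤
  atom : ∀ i a, a ≤ x i → a = ⊥ ∨ a = x i
  coatom : ∀ i a, x i ≤ a → a = x i ∨ a = ⊤

variable {x}

omit [PartialOrder L] [BoundedOrder L] [Nontrivial L] in
/-- `badKer x (x i) (x j) = 1` for `i ≠ j`. -/
theorem badKer_eq_one {i j : Fin r} (hij : i ≠ j) : badKer x (x i) (x j) = 1 := by
  unfold badKer; rw [if_pos ⟨i, j, hij, rfl, rfl⟩]

omit [Nontrivial L] in
/-- `badKer x a a = 0` for an atom–coatom family. -/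
theorem badKer_self (hx : IsAtomCoatomFamily x) (a : L) : badKer x a a = 0 := by
  unfold badKer
  rw [if_neg]
  rintro ⟨i', j', hne, hi, hj⟩
  exact hne (hx.injective (hi.symm.trans hj))

/-- The kernel vanishes on the diagonal. -/
theorem bKernel_self (hx : IsAtomCoatomFamily x) (a : L) : bKernel x a a = 0 := by
  unfold bKernel; rw [goodKer_self, badKer_self hx]; rfl

omit [Nontrivial L] in
/-- `badKer x ⊤ b = 0` for an atom–coatom family. -/
theorem badKer_top_left (hx : IsAtomCoatomFamily x) (b : L) : badKer x ⊤ b = 0 := by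
  unfold badKer
  rw [if_neg]
  rintro ⟨i, _, _, hi, _⟩
  exact hx.ne_top i hi.symm

omit [Nontrivial L] in
/-- `badKer x ⊥ b = 0` for an atom–coatom family. -/
theorem badKer_bot_left (hx : IsAtomCoatomFamily x) (b : L) : badKer x ⊥ b = 0 := by
  unfold badKer
  rw [if_neg]
  rintro ⟨i, _, _, hi, _⟩
  exact hx.ne_bot i hi.symm

omit [Nontrivial L] in
/-- `badKer x a ⊤ = 0` for an atom–coatom family. -/
theorem badKer_top_right (hx : IsAtomCoatomFamily x) (a : L) : badKer x a ⊤ = 0 := by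
  unfold badKer
  rw [if_neg]
  rintro ⟨_, j, _, _, hj⟩
  exact hx.ne_top j hj.symm

omit [Nontrivial L] in
/-- `badKer x a ⊥ = 0` for an atom–coatom family. -/
theorem badKer_bot_right (hx : IsAtomCoatomFamily x) (a : L) : badKer x a ⊥ = 0 := by
  unfold badKer
  rw [if_neg]
  rintro ⟨_, j, _, _, hj⟩
  exact hx.ne_bot j hj.symm

omit [Nontrivial L] in
/-- `goodKer (x i) b = 0` for an atom–coatom family. -/
theorem goodKer_x_left (hx : IsAtomCoatomFamily x) (i : Fin r) (b : L) : goodKer (x i) b = 0 := by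
  unfold goodKer
  simp [hx.ne_top i, hx.ne_bot i]

omit [Nontrivial L] in
/-- `goodKer a (x i) = 0` for an atom–coatom family. -/
theorem goodKer_x_right (hx : IsAtomCoatomFamily x) (i : Fin r) (a : L) : goodKer a (x i) = 0 := by
  unfold goodKer
  simp [hx.ne_top i, hx.ne_bot i]

/-- **The local kernel inequality**: for `a₀ ≤ a₁`, `b₀ ≤ b₁` the kernel on the anti-diagonal
dominates the kernel on the columns, provided the crossing cells are atoms and coatoms. -/
theorem bKernel_local (hx : IsAtomCoatomFamily x) {a₀ a₁ b₀ b₁ : L} (ha : a₀ ≤ a₁)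
    (hb : b₀ ≤ b₁) :
    bKernel x a₀ b₀ + bKernel x a₁ b₁ ≤ bKernel x a₀ b₁ + bKernel x a₁ b₀ := by
  classical
  have hg := goodKer_local ha hb
  unfold bKernel
  by_cases hA : ∃ i j, i ≠ j ∧ a₀ = x i ∧ b₁ = x j
  · obtain ⟨i, j, hij, rfl, rfl⟩ := hA
    rcases hx.coatom i a₁ ha with rfl | rfl <;> rcases hx.atom j b₀ hb with rfl | rfl <;>
      simp [badKer_eq_one hij, badKer_top_left hx, badKer_bot_right hx, goodKer_x_left hx,
        goodKer_x_right hx, goodKer_top_bot]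
  by_cases hB : ∃ i j, i ≠ j ∧ a₁ = x i ∧ b₀ = x j
  · obtain ⟨i, j, hij, rfl, rfl⟩ := hB
    rcases hx.atom i a₀ ha with rfl | rfl
    · rcases hx.coatom j b₁ hb with rfl | rfl
      · exact le_rfl
      · simp [badKer_eq_one hij, badKer_bot_left hx, badKer_top_right hx, goodKer_x_left hx,
          goodKer_x_right hx, goodKer_bot_top]
    · rcases hx.coatom j b₁ hb with rfl | rfl
      · exact absurd ⟨i, j, hij, rfl, rfl⟩ hA
      · exact (add_comm _ _).le
  · have h1 : badKer x a₀ b₁ = 0 := by unfold badKer; exact if_neg hA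
    have h2 : badKer x a₁ b₀ = 0 := by unfold badKer; exact if_neg hB
    have h3 := badKer_nonneg x a₀ b₀
    have h4 := badKer_nonneg x a₁ b₁
    rw [h1, h2]
    omega

end Kernel

/-! ### The antipodal sum of a sub-cube and the coordinate induction -/

section Cube

variable {L : Type*} [PartialOrder L] [BoundedOrder L] [Nontrivial L] {r : ℕ} {S : Type*} [DecidableEq S]

/-- The antipodal sum of the kernel on the cube of subsets of `A` (the sub-cube of the coordinates
`A`, based at the empty configuration): `σ` is paired with `A \ σ`. -/
noncomputable def cubeAntipodalSum (x : Fin r → L) (c : Finset S → L) (A : Finset S) : ℤ :=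
  ∑ σ ∈ A.powerset, bKernel x (c σ) (c (A \ σ))

/-- **Coordinate induction**: the antipodal sum of a monotone map on every sub-cube is non-negative. -/
theorem cubeAntipodalSum_nonneg {x : Fin r → L} (hx : IsAtomCoatomFamily x) (A : Finset S) :
    ∀ c : Finset S → L, Monotone c → 0 ≤ cubeAntipodalSum x c A := by
  induction A using Finset.induction_on with
  | empty =>
    intro c _
    simp only [cubeAntipodalSum, Finset.powerset_empty, Finset.sum_singleton, Finset.sdiff_empty,
      bKernel_self hx, le_refl]
  | insert r A hr ih =>
    intro c hc
    have hc' : Monotone fun σ : Finset S => c (insert r σ) :=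
      fun σ τ h => hc (Finset.insert_subset_insert r h)
    have h0 := ih c hc
    have h1 := ih _ hc'
    unfold cubeAntipodalSum at h0 h1 ⊢
    rw [Finset.powerset_insert, Finset.sum_union, Finset.sum_image]
    · have key : ∀ σ ∈ A.powerset,
          bKernel x (c σ) (c (A \ σ)) + bKernel x (c (insert r σ)) (c (insert r (A \ σ))) ≤
          bKernel x (c σ) (c (insert r A \ σ)) +
            bKernel x (c (insert r σ)) (c (insert r A \ insert r σ)) := by
        intro σ hσ
        rw [Finset.mem_powerset] at hσ
        have hrσ : r ∉ σ := fun h => hr (hσ h)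
        have e1 : insert r A \ σ = insert r (A \ σ) := by
          ext y; simp only [Finset.mem_sdiff, Finset.mem_insert]
          constructor
          · rintro ⟨hy | hy, hy'⟩
            · exact Or.inl hy
            · exact Or.inr ⟨hy, hy'⟩
          · rintro (rfl | ⟨hy, hy'⟩)
            · exact ⟨Or.inl rfl, hrσ⟩
            · exact ⟨Or.inr hy, hy'⟩
        have e2 : insert r A \ insert r σ = A \ σ := by
          ext y; simp only [Finset.mem_sdiff, Finset.mem_insert, not_or]
          constructor
          · rintro ⟨hy | hy, hy1, hy2⟩
            · exact absurd hy hy1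
            · exact ⟨hy, hy2⟩
          · rintro ⟨hy, hy'⟩
            exact ⟨Or.inr hy, fun h => hr (h ▸ hy), hy'⟩
        rw [e1, e2]
        exact bKernel_local hx (hc (Finset.subset_insert r σ))
          (hc (Finset.subset_insert r (A \ σ)))
      calc (0 : ℤ) ≤ (∑ σ ∈ A.powerset, bKernel x (c σ) (c (A \ σ))) +
            ∑ σ ∈ A.powerset, bKernel x (c (insert r σ)) (c (insert r (A \ σ))) := by
              positivity
        _ = ∑ σ ∈ A.powerset, (bKernel x (c σ) (c (A \ σ)) +
              bKernel x (c (insert r σ)) (c (insert r (A \ σ)))) := by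
              rw [Finset.sum_add_distrib]
        _ ≤ ∑ σ ∈ A.powerset, (bKernel x (c σ) (c (insert r A \ σ)) +
              bKernel x (c (insert r σ)) (c (insert r A \ insert r σ))) :=
              Finset.sum_le_sum key
        _ = _ := by rw [Finset.sum_add_distrib]
    · intro σ hσ τ hτ h
      rw [Finset.mem_coe, Finset.mem_powerset] at hσ hτ
      have hrσ : r ∉ σ := fun h' => hr (hσ h')
      have hrτ : r ∉ τ := fun h' => hr (hτ h')
      rw [← Finset.erase_insert hrσ, ← Finset.erase_insert hrτ, h]
    · rw [Finset.disjoint_left]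
      intro σ hσ hσ'
      rw [Finset.mem_powerset] at hσ
      rw [Finset.mem_image] at hσ'
      obtain ⟨τ, _, rfl⟩ := hσ'
      exact hr (hσ (Finset.mem_insert_self r τ))

end Cube

/-! ### From the full cube `Config S` to the counts -/

section Counts

variable {L : Type*} [PartialOrder L] [BoundedOrder L] [Nontrivial L] {r : ℕ} {S : Type} [Fintype S]
  [DecidableEq S]

/-- The configuration with support `A`. -/
def ofFinset (A : Finset S) : Config S := fun s => decide (s ∈ A)

omit [Fintype S] in
/-- `ofFinset` is monotone. -/
theorem ofFinset_mono : Monotone (ofFinset (S := S)) := by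
  intro A B h s
  simp only [ofFinset]
  by_cases hs : s ∈ A
  · simp [hs, h hs]
  · simp [hs]

/-- `ofFinset` turns complements into complements. -/
theorem ofFinset_compl (A : Finset S) : (ofFinset A)ᶜ = ofFinset (univ \ A) := by
  funext s
  simp [ofFinset]

/-- `ofFinset` is a bijection. -/
theorem ofFinset_bijective : Function.Bijective (ofFinset (S := S)) := by
  constructor
  · intro A B h
    ext s
    have := congrFun h s
    simpa [ofFinset] using this
  · intro ω
    refine ⟨univ.filter fun s => ω s = true, ?_⟩
    funext s
    simp only [ofFinset, Finset.mem_filter, Finset.mem_univ, true_and]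
    cases ω s <;> simp

/-- The antipodal sum on the full cube is non-negative. -/
theorem sum_bKernel_nonneg {x : Fin r → L} (hx : IsAtomCoatomFamily x)
    (c : Config S → L) (hc : Monotone c) : 0 ≤ ∑ ω : Config S, bKernel x (c ω) (c ωᶜ) := by
  have h := cubeAntipodalSum_nonneg hx (univ : Finset S) (fun A => c (ofFinset A))
    (hc.comp ofFinset_mono)
  unfold cubeAntipodalSum at h
  rw [Finset.powerset_univ] at h
  have e : ∑ ω : Config S, bKernel x (c ω) (c ωᶜ) =
      ∑ A : Finset S, bKernel x (c (ofFinset A)) (c (ofFinset (univ \ A))) := by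
    refine (Fintype.sum_bijective ofFinset ofFinset_bijective _ _ fun A => ?_).symm
    rw [ofFinset_compl]
  rw [e]
  exact h

/-- Summing `F ω ωᶜ` over all configurations equals summing `F ωᶜ ω` (complementation is a bijection). -/
theorem sum_compl_eq (F : Config S → Config S → ℤ) :
    ∑ ω : Config S, F ω ωᶜ = ∑ ω : Config S, F ωᶜ ω := by
  refine Fintype.sum_bijective compl compl_involutive.bijective _ _ fun ω => ?_
  rw [compl_compl]

end Counts
end PercRepro
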